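import Summits.ABC.ABC.Theorems.DefiniteXiPeterssonLowerBoundStubZEAux
import Literature.NumberTheory.EllipticCurves.NewformPeterssonSizeSymmSqLZeroFreeProofs
import HarnessLib

/-!
# Stub `stub_ZE` of the crux skeleton `DefiniteXi.PeterssonLowerBound` (stmt-ABC-10870), line Sketch: the GHL auxiliary function `Z_E = ζ² (L_f·corr)³ L₄` on the Siegel ball.

For a newform `f ∈ S₂(Γ₀(N))` with `L_f = symmSqL N f` (the continued imprimitive symmetric square of
`RankinSymmSquareGL2Fields`), a real zero `β ∈ (1 - r, 1)` of `L_f` (`r` the Siegel radius of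
`exists_siegel_radius`) and an entire `L₄` (the symmetric fourth power, a hypothesis here), the
Goldfeld–Hoffstein–Lieman auxiliary function `Z = ζ² (L_f · ∏_{p∣N}(1 + p^{-s}))³ L₄` has
non-negative log-coefficients (`2 + 3(P² - 1) + (P⁴ - 3P² + 1) = P⁴` at `p ∤ N`), hence `|Z| ≥ 1`
and `Re Z'/Z ≤ 0` on the real axis right of `1`; `G = ζ₁² (dslope (L_f·corr) β)³ L₄` is holomorphic
on `|s - 1| < r` with `(s - β)³ G = (s - 1)² Z`, bounded by `e^B`, `B = O(log N)` (the disc bound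
`exists_norm_symmSqL_le`, `|ζ₁| ≤ 21`, `|corr| ≤ N`, `|L₄| ≤ C N^K`), and zero-free on `Re s > 1`.
This is exactly the input of the disc-local repulsion lemma `stub_localGHL` (`m = 2`, `ρ = r`).
The abstract version `exists_GHL_auxiliary` takes arbitrary real log-coefficient systems; the
real-axis analysis is in `DefiniteXiPeterssonLowerBoundStubZEAux` (`exists_realAxis_exp`).

Reference: J. Hoffstein, P. Lockhart, Ann. of Math. 140 (1994), Appendix by D. Goldfeld,
J. Hoffstein, D. Lieman. [cite: HoffsteinLockhart1994, Appendix (Goldfeld–Hoffstein–Lieman)]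
-/

noncomputable section

open scoped Real Topology
open Set Filter Metric Complex CongruenceSubgroup
open Literature.NumberTheory.EllipticCurves.ModularForms
open Literature.NumberTheory.LFunctions

-- the summit-side namespace `Summit.ABC.ABC.Theorems` (summit = problem = `ABC`) is fixed by the tree layout
set_option linter.dupNamespace false

namespace Summit.ABC.ABC.Theorems

/-- **The GHL auxiliary function, abstract coefficients.** The construction of `stub_ZE` for
arbitrary real coefficient systems `b₂` (log-coefficients of `L_f · corr`) and `b₄` (of `L₄`)
subject only to the positivity `2/(k+1) + 3 b₂(p,k) + b₄(p,k) ≥ 0`: with the Siegel radius `r`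
(`exists_siegel_radius`) and the disc bound `‖L_f‖ ≤ B₀ N¹⁵ max(1, L_f(1))`
(`exists_norm_symmSqL_le`), given `C ≥ 1`, `K ≥ 0` take `A = B₁/log 2 + 48 + K`,
`B₁ = max(1, log(441 B₀³ C))`; for a real zero `β ∈ (1 - r, 1)` of `L_f` put
`L_♭ = L_f · ∏_{p∣N}(1 + p^{-s})`, `D = dslope L_♭ β` (so `(s - β) D = L_♭`),
`G = ζ₁² D³ L₄`, `Z = ζ² L_♭³ L₄`, `B = B₁ + (48 + K) log(N + 2)`. On `|s - 1| < r`: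
`|ζ₁| ≤ 21`, `|L_f| ≤ B₀ N¹⁵`, `|corr| ≤ N`, `|L₄| ≤ C N^K` give `|(s-β)³G| ≤ e^B`; zeros of `G`
with `Re s > 1` are impossible (`ζ₁ ≠ 0`, `L_♭ = exp ≠ 0`, `L₄ = exp ≠ 0`); `ζ₁ = (s-1)ζ` gives the
identity; on the real axis `Z = exp(T)` with `T ≥ 0` antitone (`exists_realAxis_exp`), whence
`|Z| ≥ 1` and `Re Z'/Z ≤ 0`. [cite: HoffsteinLockhart1994, Appendix (Goldfeld–Hoffstein–Lieman)] -/
theorem exists_GHL_auxiliary :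
    ∃ r : ℝ, 0 < r ∧ r ≤ 1 / 4 ∧ (∀ s ∈ ball (2 : ℂ) (1 + 2 * r), 0 < s.re ∧ riemannZeta₁ s ≠ 0) ∧
      ∀ (C K : ℝ), 1 ≤ C → 0 ≤ K → ∃ A : ℝ, 0 < A ∧
        ∀ (N : ℕ) [NeZero N] (f : CuspForm (Gamma0 N) 2) (b₂ b₄ : Nat.Primes → ℕ → ℝ),
          (∀ (p : Nat.Primes) (k : ℕ), 0 ≤ 2 * (1 / ((k : ℝ) + 1)) + 3 * b₂ p k + b₄ p k) →
          (∀ s : ℂ, 1 < s.re →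
            (∀ p : Nat.Primes, Summable fun k : ℕ ↦
              ‖((b₂ p k : ℝ) : ℂ) * (p : ℂ) ^ (-((k + 1 : ℕ) : ℂ) * s)‖) ∧
            (Summable fun p : Nat.Primes ↦ ∑' k : ℕ,
              ‖((b₂ p k : ℝ) : ℂ) * (p : ℂ) ^ (-((k + 1 : ℕ) : ℂ) * s)‖) ∧
            symmSqL N f s * ∏ p ∈ N.primeFactors, (1 + (p : ℂ) ^ (-s)) =
              Complex.exp (∑' p : Nat.Primes, ∑' k : ℕ,
                ((b₂ p k : ℝ) : ℂ) * (p : ℂ) ^ (-((k + 1 : ℕ) : ℂ) * s))) →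
          ∀ (L₄ : ℂ → ℂ), Differentiable ℂ L₄ →
            (∀ s : ℂ, 1 < s.re →
              (∀ p : Nat.Primes, Summable fun k : ℕ ↦
                ‖((b₄ p k : ℝ) : ℂ) * (p : ℂ) ^ (-((k + 1 : ℕ) : ℂ) * s)‖) ∧
              (Summable fun p : Nat.Primes ↦ ∑' k : ℕ,
                ‖((b₄ p k : ℝ) : ℂ) * (p : ℂ) ^ (-((k + 1 : ℕ) : ℂ) * s)‖) ∧
              L₄ s = Complex.exp (∑' p : Nat.Primes, ∑' k : ℕ,
                ((b₄ p k : ℝ) : ℂ) * (p : ℂ) ^ (-((k + 1 : ℕ) : ℂ) * s))) →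
            (∀ s ∈ closedBall (2 : ℂ) (3 / 2), ‖L₄ s‖ ≤ C * (N : ℝ) ^ K) →
            (symmSqL N f 1).re < 1 →
            ∀ β : ℝ, 1 - r < β → β < 1 → symmSqL N f β = 0 →
              ∃ (G Z : ℂ → ℂ) (B : ℝ), 1 ≤ B ∧ B ≤ A * Real.log (N + 2) ∧
                DifferentiableOn ℂ G (ball (1 : ℂ) r) ∧
                (∀ s ∈ ball (1 : ℂ) r, ‖(s - β) ^ (2 + 1) * G s‖ ≤ Real.exp B) ∧
                (∀ s ∈ ball (1 : ℂ) r, G s = 0 → s.re ≤ 1) ∧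
                (∀ s ∈ ball (1 : ℂ) r, s ≠ 1 → (s - β) ^ (2 + 1) * G s = (s - 1) ^ 2 * Z s) ∧
                (∀ σ : ℝ, 1 < σ → σ < 1 + r → 1 ≤ ‖Z σ‖) ∧
                (∀ σ : ℝ, 1 < σ → σ < 1 + r → (deriv Z σ / Z σ).re ≤ 0) := by
  obtain ⟨r, hr0, hr4, hr⟩ := exists_siegel_radius
  obtain ⟨B₀, hB₀, hbd⟩ := exists_norm_symmSqL_le hr0 hr4 hr
  refine ⟨r, hr0, hr4, hr, fun C K hC hK ↦ ?_⟩
  -- the constants `B₁ = max(1, log(441 B₀³ C))`, `A = B₁/log 2 + 48 + K`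
  set B₁ : ℝ := max 1 (Real.log (441 * B₀ ^ 3 * C)) with hB₁
  have hB₁1 : 1 ≤ B₁ := le_max_left _ _
  have hlog2 : 0 < Real.log 2 := Real.log_pos (by norm_num)
  have hexpB₁ : 441 * B₀ ^ 3 * C ≤ Real.exp B₁ :=
    calc 441 * B₀ ^ 3 * C = Real.exp (Real.log (441 * B₀ ^ 3 * C)) :=
          (Real.exp_log (by positivity)).symm
      _ ≤ Real.exp B₁ := Real.exp_le_exp.mpr (le_max_right _ _)
  refine ⟨B₁ / Real.log 2 + 48 + K, by positivity, ?_⟩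
  intro N _ f b₂ b₄ hc hE L₄ hL₄d hL₄E hL₄b hL1 β hβ1 hβ2 hβ0
  have hN0 : N ≠ 0 := NeZero.ne N
  have hN0' : (0 : ℝ) ≤ N := Nat.cast_nonneg N
  have hlogN : Real.log 2 ≤ Real.log (N + 2) := Real.log_le_log (by norm_num) (by linarith)
  have hlogN0 : 0 < Real.log (N + 2) := by linarith
  -- geometry: `ball 1 r ⊆ ball 2 (1 + 2r)`, `⊆ closedBall 2 (1 + r) ⊆ closedBall 2 (3/2)`
  have hd12 : dist (1 : ℂ) 2 = 1 := by
    rw [dist_eq_norm, show (1 : ℂ) - 2 = -1 by norm_num, norm_neg, norm_one]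
  have hsub2 : ball (1 : ℂ) r ⊆ ball (2 : ℂ) (1 + 2 * r) := fun s hs ↦ by
    rw [mem_ball] at hs ⊢
    linarith [dist_triangle s 1 2]
  have hsubc : ball (1 : ℂ) r ⊆ closedBall (2 : ℂ) (1 + r) := fun s hs ↦ by
    rw [mem_ball] at hs
    rw [mem_closedBall]
    linarith [dist_triangle s 1 2]
  have hsub32 : ball (1 : ℂ) r ⊆ closedBall (2 : ℂ) (3 / 2) := fun s hs ↦
    closedBall_subset_closedBall (by linarith) (hsubc hs)
  have hre : ∀ s ∈ ball (1 : ℂ) r, 1 - r < s.re := fun s hs ↦ by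
    rw [mem_ball, dist_eq_norm] at hs
    have h := abs_re_le_norm (s - 1)
    rw [sub_re, Complex.one_re] at h
    have := neg_abs_le (s.re - 1)
    linarith
  have hβmem : (β : ℂ) ∈ ball (1 : ℂ) r := by
    rw [mem_ball, dist_eq_norm, ← Complex.ofReal_one, ← Complex.ofReal_sub, Complex.norm_real,
      Real.norm_eq_abs, abs_lt]
    constructor <;> linarith
  -- the functions `L_♭ = L_f · corr`, `D = dslope L_♭ β`, `G = ζ₁² D³ L₄`, `Z = ζ² L_♭³ L₄`
  set corr : ℂ → ℂ := fun s ↦ ∏ p ∈ N.primeFactors, (1 + (p : ℂ) ^ (-s)) with hcorr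
  set Lb : ℂ → ℂ := fun s ↦ symmSqL N f s * corr s with hLb
  set D : ℂ → ℂ := dslope Lb β with hD
  have hLbβ : Lb β = 0 := by simp [hLb, hβ0]
  have hDs : ∀ s : ℂ, (s - β) * D s = Lb s := fun s ↦ by
    have h := sub_smul_dslope Lb (β : ℂ) s
    rwa [smul_eq_mul, hLbβ, sub_zero] at h
  have hLbd : DifferentiableOn ℂ Lb (ball (1 : ℂ) r) :=
    ((differentiableOn_symmSqL_ball f hr).mul (differentiable_corr N).differentiableOn).mono hsub2
  have hDd : DifferentiableOn ℂ D (ball (1 : ℂ) r) :=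
    (differentiableOn_dslope (isOpen_ball.mem_nhds hβmem)).mpr hLbd
  -- the real axis: `ζ² L_♭³ L₄ = exp(T)`, `T ≥ 0` antitone on `(1, ∞)`
  obtain ⟨T, hTanti, hT0, hTeq⟩ := exists_realAxis_exp hc (Lb := Lb) (L₄ := L₄)
    (fun y hy ↦ hE y (by simpa using hy)) (fun y hy ↦ hL₄E y (by simpa using hy))
  set G : ℂ → ℂ := fun s ↦ riemannZeta₁ s ^ 2 * D s ^ 3 * L₄ s with hG
  set Z : ℂ → ℂ := fun s ↦ riemannZeta s ^ 2 * Lb s ^ 3 * L₄ s with hZ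
  set B : ℝ := B₁ + (48 + K) * Real.log (N + 2) with hB
  refine ⟨G, Z, B, ?_, ?_, ?_, ?_, ?_, ?_, ?_, ?_⟩
  · -- `1 ≤ B`
    have : 0 ≤ (48 + K) * Real.log (N + 2) := by positivity
    linarith
  · -- `B ≤ A log(N + 2)`
    have h1 : B₁ ≤ B₁ / Real.log 2 * Real.log (N + 2) :=
      calc B₁ = B₁ / Real.log 2 * Real.log 2 := by field_simp
        _ ≤ B₁ / Real.log 2 * Real.log (N + 2) := mul_le_mul_of_nonneg_left hlogN (by positivity)
    calc B = B₁ + (48 + K) * Real.log (N + 2) := rfl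
      _ ≤ B₁ / Real.log 2 * Real.log (N + 2) + (48 + K) * Real.log (N + 2) := by linarith
      _ = (B₁ / Real.log 2 + 48 + K) * Real.log (N + 2) := by ring
  · -- holomorphy of `G` on the ball
    exact ((differentiable_riemannZeta₁.differentiableOn.pow 2).mul (hDd.pow 3)).mul
      hL₄d.differentiableOn
  · -- the bound `|(s - β)³ G(s)| ≤ e^B`
    intro s hs
    have hsc := hsubc hs
    have hs32 := hsub32 hs
    have hres : 0 ≤ s.re := by linarith [hre s hs]
    have e : (s - β) ^ (2 + 1) * G s = riemannZeta₁ s ^ 2 * Lb s ^ 3 * L₄ s := by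
      rw [← hDs s]
      simp only [hG]
      ring
    have h1 : ‖riemannZeta₁ s‖ ≤ 21 := EstermannDisc.norm_riemannZeta₁_le_of_mem_closedBall hs32
    have h2 : ‖Lb s‖ ≤ B₀ * N ^ 16 := by
      have h21 : ‖symmSqL N f s‖ ≤ B₀ * N ^ 15 := by
        have := hbd N f s hsc
        rwa [max_eq_left hL1.le, mul_one] at this
      have h22 : ‖corr s‖ ≤ N := norm_corr_le hN0 hres
      calc ‖Lb s‖ = ‖symmSqL N f s‖ * ‖corr s‖ := norm_mul _ _
        _ ≤ B₀ * N ^ 15 * N := mul_le_mul h21 h22 (norm_nonneg _) (by positivity)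
        _ = B₀ * N ^ 16 := by ring
    have h3 : ‖L₄ s‖ ≤ C * N ^ K := hL₄b s hs32
    have hpow : (N : ℝ) ^ 48 * (N : ℝ) ^ K ≤ (N + 2 : ℝ) ^ (48 + K) := by
      rw [Real.rpow_add (by linarith : (0 : ℝ) < N + 2), ← Real.rpow_natCast]
      push_cast
      gcongr <;> linarith
    rw [e, norm_mul, norm_mul, norm_pow, norm_pow]
    calc ‖riemannZeta₁ s‖ ^ 2 * ‖Lb s‖ ^ 3 * ‖L₄ s‖
          ≤ 21 ^ 2 * (B₀ * N ^ 16) ^ 3 * (C * N ^ K) := by gcongr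
      _ = (441 * B₀ ^ 3 * C) * ((N : ℝ) ^ 48 * N ^ K) := by ring
      _ ≤ Real.exp B₁ * (N + 2 : ℝ) ^ (48 + K) :=
          mul_le_mul hexpB₁ hpow (by positivity) (by positivity)
      _ = Real.exp B := by
          rw [hB, Real.exp_add, mul_comm (48 + K), Real.rpow_def_of_pos (by linarith)]
  · -- zeros of `G` in the ball have `Re s ≤ 1`
    intro s _ hGs
    by_contra h
    push Not at h
    have hζ : riemannZeta₁ s ≠ 0 := riemannZeta₁_ne_zero_of_one_le_re' h.le
    have hLbs : Lb s ≠ 0 := by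
      show symmSqL N f s * ∏ p ∈ N.primeFactors, (1 + (p : ℂ) ^ (-s)) ≠ 0
      rw [(hE s h).2.2]
      exact Complex.exp_ne_zero _
    have hDs0 : D s ≠ 0 := by
      intro h0
      have := hDs s
      rw [h0, mul_zero] at this
      exact hLbs this.symm
    have hL₄s : L₄ s ≠ 0 := by
      rw [(hL₄E s h).2.2]
      exact Complex.exp_ne_zero _
    exact (mul_ne_zero (mul_ne_zero (pow_ne_zero _ hζ) (pow_ne_zero _ hDs0)) hL₄s) hGs
  · -- the identity `(s - β)³ G = (s - 1)² Z` off `s = 1`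
    intro s _ hs1
    have hζ₁ : riemannZeta₁ s = (s - 1) * riemannZeta s := by
      rw [riemannZeta_eq_inv_sub_mul hs1, ← mul_assoc, mul_inv_cancel₀ (sub_ne_zero.mpr hs1),
        one_mul]
    calc (s - β) ^ (2 + 1) * G s = riemannZeta₁ s ^ 2 * ((s - β) * D s) ^ 3 * L₄ s := by
          simp only [hG]; ring
      _ = ((s - 1) * riemannZeta s) ^ 2 * Lb s ^ 3 * L₄ s := by rw [hDs, hζ₁]
      _ = (s - 1) ^ 2 * Z s := by simp only [hZ]; ring
  · -- `|Z(σ)| ≥ 1` on `(1, 1 + r)`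
    intro σ h1 _
    exact one_le_norm_of_eq_ofReal (g := fun y ↦ Real.exp (T y))
      (Real.one_le_exp_iff.mpr (hT0 σ h1)) (hTeq σ h1)
  · -- `Re Z'/Z(σ) ≤ 0` on `(1, 1 + r)`
    intro σ h1 h2
    have hσmem : (σ : ℂ) ∈ ball (2 : ℂ) (1 + 2 * r) :=
      ofReal_mem_siegel_ball (by linarith) (by linarith)
    have hσ1 : (σ : ℂ) ≠ 1 := by
      intro h
      have := congrArg Complex.re h
      simp at this
      linarith
    have hLbσ : DifferentiableAt ℂ Lb σ :=
      ((differentiableOn_symmSqL_ball f hr).differentiableAt (isOpen_ball.mem_nhds hσmem)).mul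
        (differentiable_corr N _)
    have hZd : DifferentiableAt ℂ Z σ :=
      (((differentiableAt_riemannZeta hσ1).pow 2).mul (hLbσ.pow 3)).mul (hL₄d _)
    exact re_deriv_div_nonpos_of_antitoneOn (g := fun y ↦ Real.exp (T y)) h1 hZd
      (fun a ha b hb hab ↦ Real.exp_le_exp.mpr (hTanti ha hb hab)) (Real.exp_pos _) hTeq

/-- **The GHL auxiliary function on the Siegel ball.** There is `r ∈ (0, 1/4]` (the Siegel radius)
such that for all constants `C ≥ 1`, `K ≥ 0` there is `A > 0` with: for every newform
`f ∈ S₂(Γ₀(N))` whose `L_f · corr` has the log-Euler product of `stub_symmSqL_logEuler`, every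
entire `L₄` which on `Re s > 1` is `exp` of the good-prime symmetric-fourth log series
(coefficients `(P_k⁴ - 3P_k² + 1)/k`) and satisfies `|L₄| ≤ C N^K` on `|s - 2| ≤ 3/2`, if
`L_f(1) < 1` and `β ∈ (1 - r, 1)` is a real zero of `L_f`, then
`G = ζ₁² (dslope (L_f·corr) β)³ L₄`, `Z = ζ² (L_f·corr)³ L₄`, `B = A log(N+2)` satisfy the
hypotheses of `stub_localGHL` with `m = 2`, `ρ = r` (log-coefficients of `Z` at `p^k ∤ N`:
`2 + 3(P_k² - 1) + (P_k⁴ - 3P_k² + 1) = P_k⁴ ≥ 0`). [cite: HoffsteinLockhart1994, Appendix (Goldfeld–Hoffstein–Lieman)] -/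
theorem stub_ZE :
    ∃ r : ℝ, 0 < r ∧ r ≤ 1 / 4 ∧ (∀ s ∈ ball (2 : ℂ) (1 + 2 * r), 0 < s.re ∧ riemannZeta₁ s ≠ 0) ∧
      ∀ (C K : ℝ), 1 ≤ C → 0 ≤ K → ∃ A : ℝ, 0 < A ∧
        ∀ (N : ℕ) [NeZero N] (f : CuspForm (Gamma0 N) 2), IsNewform0 f →
          -- log-Euler product of `L_f · corr` (the statement of `stub_symmSqL_logEuler`)
          (∀ s : ℂ, 1 < s.re →
            (∀ p : Nat.Primes, Summable fun k : ℕ ↦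
              ‖((if ¬ (p : ℕ) ∣ N then
                    (((Polynomial.Chebyshev.C ℝ (k + 1)).eval ((cuspCoeff f p).re / Real.sqrt p)) ^ 2 - 1) /
                      (k + 1)
                  else if ¬ (p : ℕ) ^ 2 ∣ N then ((p : ℝ) ^ (k + 1))⁻¹ / (k + 1) else 0 : ℝ) : ℂ) *
                (p : ℂ) ^ (-((k + 1 : ℕ) : ℂ) * s)‖) ∧
            (Summable fun p : Nat.Primes ↦ ∑' k : ℕ,
              ‖((if ¬ (p : ℕ) ∣ N then
                    (((Polynomial.Chebyshev.C ℝ (k + 1)).eval ((cuspCoeff f p).re / Real.sqrt p)) ^ 2 - 1) /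
                      (k + 1)
                  else if ¬ (p : ℕ) ^ 2 ∣ N then ((p : ℝ) ^ (k + 1))⁻¹ / (k + 1) else 0 : ℝ) : ℂ) *
                (p : ℂ) ^ (-((k + 1 : ℕ) : ℂ) * s)‖) ∧
            symmSqL N f s * ∏ p ∈ N.primeFactors, (1 + (p : ℂ) ^ (-s)) =
              Complex.exp (∑' p : Nat.Primes, ∑' k : ℕ,
                ((if ¬ (p : ℕ) ∣ N then
                    (((Polynomial.Chebyshev.C ℝ (k + 1)).eval ((cuspCoeff f p).re / Real.sqrt p)) ^ 2 - 1) /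
                      (k + 1)
                  else if ¬ (p : ℕ) ^ 2 ∣ N then ((p : ℝ) ^ (k + 1))⁻¹ / (k + 1) else 0 : ℝ) : ℂ) *
                (p : ℂ) ^ (-((k + 1 : ℕ) : ℂ) * s))) →
          -- the symmetric-fourth data
          ∀ (L₄ : ℂ → ℂ), Differentiable ℂ L₄ →
            (∀ s : ℂ, 1 < s.re →
              (∀ p : Nat.Primes, Summable fun k : ℕ ↦
                ‖((if ¬ (p : ℕ) ∣ N then
                      (((Polynomial.Chebyshev.C ℝ (k + 1)).eval ((cuspCoeff f p).re / Real.sqrt p)) ^ 4 -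
                        3 * ((Polynomial.Chebyshev.C ℝ (k + 1)).eval ((cuspCoeff f p).re / Real.sqrt p)) ^ 2 +
                          1) / (k + 1)
                    else 0 : ℝ) : ℂ) * (p : ℂ) ^ (-((k + 1 : ℕ) : ℂ) * s)‖) ∧
              (Summable fun p : Nat.Primes ↦ ∑' k : ℕ,
                ‖((if ¬ (p : ℕ) ∣ N then
                      (((Polynomial.Chebyshev.C ℝ (k + 1)).eval ((cuspCoeff f p).re / Real.sqrt p)) ^ 4 -
                        3 * ((Polynomial.Chebyshev.C ℝ (k + 1)).eval ((cuspCoeff f p).re / Real.sqrt p)) ^ 2 +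
                          1) / (k + 1)
                    else 0 : ℝ) : ℂ) * (p : ℂ) ^ (-((k + 1 : ℕ) : ℂ) * s)‖) ∧
              L₄ s = Complex.exp (∑' p : Nat.Primes, ∑' k : ℕ,
                ((if ¬ (p : ℕ) ∣ N then
                      (((Polynomial.Chebyshev.C ℝ (k + 1)).eval ((cuspCoeff f p).re / Real.sqrt p)) ^ 4 -
                        3 * ((Polynomial.Chebyshev.C ℝ (k + 1)).eval ((cuspCoeff f p).re / Real.sqrt p)) ^ 2 +
                          1) / (k + 1)
                    else 0 : ℝ) : ℂ) * (p : ℂ) ^ (-((k + 1 : ℕ) : ℂ) * s))) →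
            (∀ s ∈ closedBall (2 : ℂ) (3 / 2), ‖L₄ s‖ ≤ C * (N : ℝ) ^ K) →
            (symmSqL N f 1).re < 1 →
            ∀ β : ℝ, 1 - r < β → β < 1 → symmSqL N f β = 0 →
              ∃ (G Z : ℂ → ℂ) (B : ℝ), 1 ≤ B ∧ B ≤ A * Real.log (N + 2) ∧
                DifferentiableOn ℂ G (ball (1 : ℂ) r) ∧
                (∀ s ∈ ball (1 : ℂ) r, ‖(s - β) ^ (2 + 1) * G s‖ ≤ Real.exp B) ∧
                (∀ s ∈ ball (1 : ℂ) r, G s = 0 → s.re ≤ 1) ∧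
                (∀ s ∈ ball (1 : ℂ) r, s ≠ 1 → (s - β) ^ (2 + 1) * G s = (s - 1) ^ 2 * Z s) ∧
                (∀ σ : ℝ, 1 < σ → σ < 1 + r → 1 ≤ ‖Z σ‖) ∧
                (∀ σ : ℝ, 1 < σ → σ < 1 + r → (deriv Z σ / Z σ).re ≤ 0) := by
  obtain ⟨r, hr0, hr4, hr, h⟩ := exists_GHL_auxiliary
  refine ⟨r, hr0, hr4, hr, fun C K hC hK ↦ ?_⟩
  obtain ⟨A, hA, hmain⟩ := h C K hC hK
  refine ⟨A, hA, fun N _ f _ hE L₄ hL₄d hL₄E hL₄b hL1 β hβ1 hβ2 hβ0 ↦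
    hmain N f _ _ ?_ hE L₄ hL₄d hL₄E hL₄b hL1 β hβ1 hβ2 hβ0⟩
  -- positivity of the combined log-coefficients: `2 + 3(P² - 1) + (P⁴ - 3P² + 1) = P⁴`
  intro p k
  split_ifs <;> first
    | positivity
    | (have hP := sq_nonneg
          (((Polynomial.Chebyshev.C ℝ (k + 1)).eval ((cuspCoeff f p).re / Real.sqrt p)) ^ 2)
       rw [mul_one_div, mul_div_assoc', ← add_div, ← add_div]
       exact div_nonneg (by nlinarith [hP]) (by positivity))

end Summit.ABC.ABC.Theorems

end
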